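import Literature.Probability.RandomPlanarGeometry.SAWCubeRouting
import HarnessLib

/-!
# Surgery on a self-avoiding walk inside a cube: splicing, first and last visits

Topic `Literature/Probability/RandomPlanarGeometry`, infrastructure for Kesten's Pattern Theorem
(Madras–Slade, *The Self-Avoiding Walk* (1993), §7.2), on top of `SAWCubeRouting.lean`
(`PathOn`, `pappend`). In the proofs of Lemma 7.2.6 and Theorem 7.2.3 a walk `ω ∈ S_N` is
modified at a site `j`: if all visits of `ω` to the cube `B = ω(j) + [-R, R]^{d+2}` happen in a
time window around `j`, then between the first visit `σ` and the last visit `τ` the walk may be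
replaced by any self-avoiding path inside `B` with the same endpoints ("replace each subwalk
`(ω(σ_l), …, ω(τ_l))` by a subwalk that stays inside `Q(j_l)`"), the result being self-avoiding
because the walk is outside `B` before `σ` and after `τ`.

## Contents (namespace `Literature.Probability.RandomPlanarGeometry.SAW.Zd`; all PROVED)

* `splice ω σ τ L π` — replace `ω[σ, τ]` by `π[0, L]`: value lemmas `splice_of_le`,
  `splice_piece`, `splice_after`; **`splice_splice`** (splicing the old piece back undoes the
  splice — the decoding step of the counting arguments); **`pathOn_splice`** (self-avoidance of
  the splice when prefix and suffix avoid the new piece).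
* `InBall R c z` (the cube of radius `R` around `c`), `exists_abs_eq_of_adj_not_inBall` (a point
  of the cube with a neighbour outside lies on the outer layer), `firstVisit` / `lastVisit` and
  their API.
* `SurgerySite ω N R j a b` — the hypotheses of a surgery site (window `[a, b] ⊆ [1, N-1]`
  containing all visits to the cube, a second visit, `R ≥ 0`) and its consequences:
  `first_spec`, `last_spec`, `first_lt_last`, `entry_outer`, `exit_outer`, `entry_ne_exit`
  (so the routing theorems `exists_route` / `exists_snake_route` apply to `x = ω(σ)`,
  `y = ω(τ)`), and **`SurgerySite.splice_mem_saws`**: the spliced walk is in `S_{σ + L + (N-τ)}`.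

## References

* N. Madras, G. Slade, *The Self-Avoiding Walk*, Birkhäuser (1993), §7.2, proof of Lemma 7.2.6
  (the replacement of `(ω(σ_l), …, ω(τ_l))`, eqs. (7.2.17)–(7.2.19)) and of Theorem 7.2.3.
-/

noncomputable section

open Filter Topology Literature.Probability.LatticeModels Literature.Probability.Percolation SimpleGraph
open scoped BigOperators

namespace Literature.Probability.RandomPlanarGeometry.SAW.Zd

/-! ### Splicing a piece into a walk -/

section Splice

variable {D : ℕ}

/-- **Splice**: replace the piece `ω[σ, τ]` of `ω` by the piece `π[0, L]` (time-shifting the rest):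
`ω(0), …, ω(σ) = π(0), π(1), …, π(L) = ω(τ), ω(τ+1), …`. [cite: MadrasSlade1993, Lemma 7.2.6 (proof)] -/
def splice (ω : ℕ → Site D) (σ τ L : ℕ) (π : ℕ → Site D) : ℕ → Site D :=
  fun t => if t ≤ σ then ω t else if t ≤ σ + L then π (t - σ) else ω (t - σ - L + τ)

variable {ω π : ℕ → Site D} {σ τ L : ℕ}

/-- Values of the splice before the piece. [folklore] -/
theorem splice_of_le {t : ℕ} (ht : t ≤ σ) : splice ω σ τ L π t = ω t := by simp [splice, ht]

/-- Values of the splice on the piece. [folklore] -/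
theorem splice_piece (hj : π 0 = ω σ) {s : ℕ} (hs : s ≤ L) : splice ω σ τ L π (σ + s) = π s := by
  rcases Nat.eq_zero_or_pos s with rfl | hpos
  · simp [splice, hj]
  · simp only [splice, if_neg (show ¬ σ + s ≤ σ by omega), if_pos (show σ + s ≤ σ + L by omega),
      Nat.add_sub_cancel_left]

/-- Values of the splice after the piece. [folklore] -/
theorem splice_after (hj : π 0 = ω σ) (hj' : π L = ω τ) (u : ℕ) :
    splice ω σ τ L π (σ + L + u) = ω (τ + u) := by
  rcases Nat.eq_zero_or_pos u with rfl | hpos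
  · rcases Nat.eq_zero_or_pos L with rfl | hL
    · simp [splice, ← hj', hj]
    · simp only [splice, add_zero, if_neg (show ¬ σ + L ≤ σ by omega), if_pos le_rfl,
        Nat.add_sub_cancel_left, hj']
  · simp only [splice, if_neg (show ¬ σ + L + u ≤ σ by omega), if_neg (show ¬ σ + L + u ≤ σ + L by omega)]
    congr 1; omega

/-- **Splicing back the old piece undoes the splice.** [folklore] -/
theorem splice_splice (hστ : σ ≤ τ) (hj : π 0 = ω σ) (hj' : π L = ω τ) :
    splice (splice ω σ τ L π) σ (σ + L) (τ - σ) (fun s => ω (σ + s)) = ω := by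
  funext t
  rcases le_or_gt t σ with h | h
  · rw [splice_of_le h, splice_of_le h]
  · rcases le_or_gt t τ with h' | h'
    · obtain ⟨s, rfl⟩ : ∃ s, t = σ + s := ⟨t - σ, by omega⟩
      rw [splice_piece (by simp [splice_of_le le_rfl]) (by omega)]
    · obtain ⟨u, rfl⟩ : ∃ u, t = σ + (τ - σ) + u := ⟨t - τ, by omega⟩
      rw [splice_after (by show ω (σ + 0) = _; rw [add_zero, splice_of_le le_rfl])
        (by show ω (σ + (τ - σ)) = _; rw [show σ + (τ - σ) = τ by omega, ← add_zero (σ + L),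
          splice_after hj hj' 0, add_zero]), splice_after hj hj' u]
      congr 1; omega

/-- **The splice of a self-avoiding path into a self-avoiding walk is self-avoiding** when the
prefix `ω[0, σ)` and the suffix `ω(τ, N]` avoid the new piece, and `σ ≤ τ`.
[cite: MadrasSlade1993, Lemma 7.2.6 (proof)] -/
theorem pathOn_splice {N : ℕ} (hω : PathOn N ω) (hστ : σ ≤ τ) (hτ : τ ≤ N) (hπ : PathOn L π)
    (hj : π 0 = ω σ) (hj' : π L = ω τ)
    (hpre : ∀ s < σ, ∀ t ≤ L, ω s ≠ π t) (hsuf : ∀ u, τ < u → u ≤ N → ∀ t ≤ L, ω u ≠ π t) :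
    PathOn (σ + L + (N - τ)) (splice ω σ τ L π) := by
  -- the splice is `(ω|[0,σ] ++ π) ++ ω(τ + ·)`
  have hA : PathOn σ ω := hω.mono (by omega)
  have hAB : PathOn (σ + L) (pappend σ ω π) :=
    hA.append hπ hj.symm fun s hs t _ ht2 => hpre s hs t ht2
  have hC : PathOn (N - τ) (fun u => ω (τ + u)) := hω.shift hτ
  have hjC : pappend σ ω π (σ + L) = (fun u => ω (τ + u)) 0 := by
    rw [pappend_add _ _ _ _ hj.symm, hj']; rfl
  have hABC := hAB.append hC hjC fun s hs u hu1 hu2 heq => ?_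
  · -- identify the splice with the double append
    refine ⟨fun t ht => ?_, fun s hs t ht hst => ?_⟩
    · have e : ∀ r ≤ σ + L + (N - τ), splice ω σ τ L π r = pappend (σ + L) (pappend σ ω π) (fun u => ω (τ + u)) r := by
        intro r _
        rcases le_or_gt r σ with h | h
        · rw [splice_of_le h, pappend_of_le _ _ (by omega), pappend_of_le _ _ h]
        · rcases le_or_gt r (σ + L) with h' | h'
          · obtain ⟨k, rfl⟩ : ∃ k, r = σ + k := ⟨r - σ, by omega⟩
            rw [splice_piece hj (by omega), pappend_of_le _ _ h', pappend_add _ _ _ _ hj.symm]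
          · obtain ⟨k, rfl⟩ : ∃ k, r = σ + L + k := ⟨r - σ - L, by omega⟩
            rw [splice_after hj hj', pappend_add _ _ _ _ hjC]
      rw [e t ht.le, e (t + 1) ht]
      exact hABC.1 t ht
    · simp only [Set.mem_setOf_eq] at hs ht
      have e : ∀ r ≤ σ + L + (N - τ), splice ω σ τ L π r = pappend (σ + L) (pappend σ ω π) (fun u => ω (τ + u)) r := by
        intro r _
        rcases le_or_gt r σ with h | h
        · rw [splice_of_le h, pappend_of_le _ _ (by omega), pappend_of_le _ _ h]
        · rcases le_or_gt r (σ + L) with h' | h'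
          · obtain ⟨k, rfl⟩ : ∃ k, r = σ + k := ⟨r - σ, by omega⟩
            rw [splice_piece hj (by omega), pappend_of_le _ _ h', pappend_add _ _ _ _ hj.symm]
          · obtain ⟨k, rfl⟩ : ∃ k, r = σ + L + k := ⟨r - σ - L, by omega⟩
            rw [splice_after hj hj', pappend_add _ _ _ _ hjC]
      rw [e s hs, e t ht] at hst
      exact hABC.2 hs ht hst
  · -- disjointness for the second append: prefix points are `ω s'` (`s' ≤ σ`) or `π t` (`t ≤ L`)
    rcases le_or_gt s σ with h | h
    · rw [pappend_of_le _ _ h] at heq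
      have := hω.2 (show s ≤ N by omega) (show τ + u ≤ N by omega) heq
      omega
    · obtain ⟨k, rfl⟩ : ∃ k, s = σ + k := ⟨s - σ, by omega⟩
      rw [pappend_add _ _ _ _ hj.symm] at heq
      exact hsuf (τ + u) (by omega) (by omega) k (by omega) heq.symm

end Splice

/-! ### Cubes around a site, first and last visits -/

section Visits

variable {d : ℕ}

/-- The cube (ball for `‖·‖∞`) of radius `R` around `c`. [cite: MadrasSlade1993, Definition 7.2.1] -/
def InBall (R : ℤ) (c z : Site (d + 2)) : Prop := ∀ k, |z k - c k| ≤ R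

/-- A neighbour outside the cube forces a point of the cube onto its outer layer. [folklore] -/
theorem exists_abs_eq_of_adj_not_inBall {R : ℤ} {c z p : Site (d + 2)} (hz : InBall R c z)
    (hp : ¬ InBall R c p) (hadj : (zdGraph (d + 2)).Adj z p) : ∃ k, |z k - c k| = R := by
  by_contra h
  push Not at h
  apply hp
  intro k
  have h1 := hz k
  have h2 : |z k - c k| ≠ R := h k
  have h3 := abs_sub_le_one_of_adj hadj k
  have : |z k - c k| ≤ R - 1 := by omega
  calc |p k - c k| = |(p k - z k) + (z k - c k)| := by ring_nf
    _ ≤ |p k - z k| + |z k - c k| := abs_add_le _ _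
    _ ≤ 1 + (R - 1) := add_le_add h3 this
    _ = R := by ring

open Classical in
/-- The first time at which `ω` visits the cube of radius `R` around `c` (given some visit).
[cite: MadrasSlade1993, Lemma 7.2.6 (proof)] -/
def firstVisit (R : ℤ) (c : Site (d + 2)) (ω : ℕ → Site (d + 2)) (h : ∃ t, InBall R c (ω t)) : ℕ :=
  Nat.find h

open Classical in
/-- The last time `≤ N` at which `ω` visits the cube of radius `R` around `c`.
[cite: MadrasSlade1993, Lemma 7.2.6 (proof)] -/
def lastVisit (R : ℤ) (c : Site (d + 2)) (ω : ℕ → Site (d + 2)) (N : ℕ) : ℕ :=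
  Nat.findGreatest (fun t => InBall R c (ω t)) N

variable {R : ℤ} {c : Site (d + 2)} {ω : ℕ → Site (d + 2)} {N : ℕ}

/-- The first visit is a visit. [folklore] -/
theorem inBall_firstVisit (h : ∃ t, InBall R c (ω t)) : InBall R c (ω (firstVisit R c ω h)) := by
  classical
  exact Nat.find_spec h

/-- No visit before the first visit. [folklore] -/
theorem not_inBall_of_lt_firstVisit (h : ∃ t, InBall R c (ω t)) {t : ℕ} (ht : t < firstVisit R c ω h) :
    ¬ InBall R c (ω t) := by
  classical
  exact Nat.find_min h ht

/-- The first visit is at most any visit. [folklore] -/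
theorem firstVisit_le (h : ∃ t, InBall R c (ω t)) {t : ℕ} (ht : InBall R c (ω t)) : firstVisit R c ω h ≤ t := by
  classical
  exact Nat.find_min' h ht

/-- The last visit is at most `N`. [folklore] -/
theorem lastVisit_le : lastVisit R c ω N ≤ N := by
  classical
  exact Nat.findGreatest_le (P := fun t => InBall R c (ω t)) N

/-- Any visit `≤ N` is at most the last visit. [folklore] -/
theorem le_lastVisit {t : ℕ} (ht : t ≤ N) (h : InBall R c (ω t)) : t ≤ lastVisit R c ω N := by
  classical
  exact Nat.le_findGreatest ht h

/-- The last visit is a visit (given some visit `≤ N`). [folklore] -/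
theorem inBall_lastVisit {t : ℕ} (ht : t ≤ N) (h : InBall R c (ω t)) : InBall R c (ω (lastVisit R c ω N)) := by
  classical
  exact Nat.findGreatest_spec (P := fun t => InBall R c (ω t)) ht h

/-- No visit after the last visit (up to `N`). [folklore] -/
theorem not_inBall_of_lastVisit_lt {t : ℕ} (h1 : lastVisit R c ω N < t) (h2 : t ≤ N) : ¬ InBall R c (ω t) := by
  classical
  exact Nat.findGreatest_is_greatest h1 h2

end Visits

/-! ### The single-site surgery -/

section Surgery

variable {d : ℕ} {N : ℕ} {ω : ℕ → Site (d + 2)} {R : ℤ} {j a b : ℕ}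

/-- Data of a **surgery site**: the walk `ω ∈ S_N`, the centre `ω(j)`, a window `[a, b] ⊆ [1, N-1]`
containing `j` and all the visits of `ω` to the cube `B = ω(j) + [-R, R]^{d+2}`, and at least
one visit other than `j`. [cite: MadrasSlade1993, Lemma 7.2.6 (proof)] -/
structure SurgerySite (ω : ℕ → Site (d + 2)) (N : ℕ) (R : ℤ) (j a b : ℕ) : Prop where
  mem : ω ∈ saws (d + 2) N
  one_le : 1 ≤ a
  le_j : a ≤ j
  j_le : j ≤ b
  lt_N : b + 1 ≤ N
  visits : ∀ t ≤ N, InBall R (ω j) (ω t) → a ≤ t ∧ t ≤ b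
  rich : ∃ t ≤ N, t ≠ j ∧ InBall R (ω j) (ω t)
  nonneg : 0 ≤ R

variable (h : SurgerySite ω N R j a b)
include h

/-- The centre is visited (at time `j`). [folklore] -/
theorem SurgerySite.exists_visit : ∃ t, InBall R (ω j) (ω t) :=
  ⟨j, fun k => by simp [h.nonneg]⟩

/-- `σ`, the first visit. [folklore] -/
theorem SurgerySite.first_spec :
    a ≤ firstVisit R (ω j) ω h.exists_visit ∧ firstVisit R (ω j) ω h.exists_visit ≤ j := by
  have h1 : firstVisit R (ω j) ω h.exists_visit ≤ j := firstVisit_le _ fun k => by simp [h.nonneg]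
  exact ⟨(h.visits _ (by have := h.j_le; have := h.lt_N; omega) (inBall_firstVisit _)).1, h1⟩

/-- `τ`, the last visit. [folklore] -/
theorem SurgerySite.last_spec :
    j ≤ lastVisit R (ω j) ω N ∧ lastVisit R (ω j) ω N ≤ b := by
  have hjN : j ≤ N := by have := h.j_le; have := h.lt_N; omega
  have hjin : InBall R (ω j) (ω j) := fun k => by simp [h.nonneg]
  exact ⟨le_lastVisit hjN hjin, (h.visits _ lastVisit_le (inBall_lastVisit hjN hjin)).2⟩

/-- `σ < τ`. [folklore] -/
theorem SurgerySite.first_lt_last : firstVisit R (ω j) ω h.exists_visit < lastVisit R (ω j) ω N := by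
  obtain ⟨t, ht, htj, hin⟩ := h.rich
  have h1 := firstVisit_le h.exists_visit hin
  have h2 := le_lastVisit ht hin
  have h3 := h.first_spec.2
  have h4 := h.last_spec.1
  omega

/-- The entry point `x = ω(σ)` lies on the outer layer of the cube. [folklore] -/
theorem SurgerySite.entry_outer : ∃ k, |ω (firstVisit R (ω j) ω h.exists_visit) k - ω j k| = R := by
  have hσ1 : 1 ≤ firstVisit R (ω j) ω h.exists_visit := le_trans h.one_le h.first_spec.1
  obtain ⟨h0, hend, hadj, hinj⟩ := mem_saws.1 h.mem
  have hprev := not_inBall_of_lt_firstVisit h.exists_visit (show firstVisit R (ω j) ω h.exists_visit - 1 < _ by omega)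
  have hadj' := hadj (firstVisit R (ω j) ω h.exists_visit - 1) (by have := h.first_spec.2; have := h.j_le; have := h.lt_N; omega)
  rw [show firstVisit R (ω j) ω h.exists_visit - 1 + 1 = firstVisit R (ω j) ω h.exists_visit by omega] at hadj'
  exact exists_abs_eq_of_adj_not_inBall (inBall_firstVisit _) hprev hadj'.symm

/-- The exit point `y = ω(τ)` lies on the outer layer of the cube. [folklore] -/
theorem SurgerySite.exit_outer : ∃ k, |ω (lastVisit R (ω j) ω N) k - ω j k| = R := by
  obtain ⟨h0, hend, hadj, hinj⟩ := mem_saws.1 h.mem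
  have hτ : lastVisit R (ω j) ω N + 1 ≤ N := by have := h.last_spec.2; have := h.lt_N; omega
  have hnext := not_inBall_of_lastVisit_lt (Nat.lt_succ_self _) hτ
  have hjN : j ≤ N := by have := h.j_le; have := h.lt_N; omega
  exact exists_abs_eq_of_adj_not_inBall (inBall_lastVisit hjN fun k => by simp [h.nonneg]) hnext
    (hadj _ (by omega))

/-- The entry and exit points are distinct. [folklore] -/
theorem SurgerySite.entry_ne_exit : ω (firstVisit R (ω j) ω h.exists_visit) ≠ ω (lastVisit R (ω j) ω N) := by
  intro e
  have := (mem_saws.1 h.mem).2.2.2 (show firstVisit R (ω j) ω h.exists_visit ≤ N by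
    have := h.first_spec.2; have := h.j_le; have := h.lt_N; omega) (show lastVisit R (ω j) ω N ≤ N from lastVisit_le) e
  have := h.first_lt_last
  omega

/-- **The single-site surgery.** Replacing the piece of `ω` between its first and last visits
`σ < τ` to the cube by any self-avoiding path `π` inside the cube from `ω(σ)` to `ω(τ)` gives a
self-avoiding walk `ψ ∈ S_{N'}`, `N' = σ + L + (N - τ)` (the points before `σ` and after `τ` lie
outside the cube). [cite: MadrasSlade1993, Lemma 7.2.6 (proof)] -/
theorem SurgerySite.splice_mem_saws {L : ℕ} {π : ℕ → Site (d + 2)} (hπ : PathOn L π)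
    (hπ0 : π 0 = ω (firstVisit R (ω j) ω h.exists_visit)) (hπL : π L = ω (lastVisit R (ω j) ω N))
    (hπin : ∀ t ≤ L, InBall R (ω j) (π t)) :
    splice ω (firstVisit R (ω j) ω h.exists_visit) (lastVisit R (ω j) ω N) L π ∈
      saws (d + 2) (firstVisit R (ω j) ω h.exists_visit + L + (N - lastVisit R (ω j) ω N)) := by
  set σ := firstVisit R (ω j) ω h.exists_visit with hσ
  set τ := lastVisit R (ω j) ω N with hτ
  obtain ⟨h0, hend, hadj, hinj⟩ := mem_saws.1 h.mem
  have hστ : σ < τ := h.first_lt_last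
  have hτN : τ ≤ N := lastVisit_le
  have hP := pathOn_splice (pathOn_of_mem_saws h.mem) hστ.le hτN hπ hπ0 hπL
    (fun s hs t ht e => not_inBall_of_lt_firstVisit h.exists_visit hs (e ▸ hπin t ht))
    (fun u hu1 hu2 t ht e => not_inBall_of_lastVisit_lt hu1 hu2 (e ▸ hπin t ht))
  refine mem_saws_of_pathOn hP ?_ ?_
  · rw [splice_of_le (Nat.zero_le _), h0]
  · intro t ht
    obtain ⟨u, rfl⟩ : ∃ u, t = σ + L + u := ⟨t - (σ + L), by omega⟩
    rw [splice_after hπ0 hπL, splice_after hπ0 hπL, hend (τ + u) (by omega), hend (τ + (N - τ)) (by omega)]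

/-- Values of the surgered walk: before `σ` it is `ω`. [folklore] -/
theorem SurgerySite.splice_before {L : ℕ} {π : ℕ → Site (d + 2)} {t : ℕ}
    (ht : t ≤ firstVisit R (ω j) ω h.exists_visit) :
    splice ω (firstVisit R (ω j) ω h.exists_visit) (lastVisit R (ω j) ω N) L π t = ω t :=
  splice_of_le ht

end Surgery

end Literature.Probability.RandomPlanarGeometry.SAW.Zd
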